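import Mathlib
import HarnessLib
import Literature.NumberTheory.LFunctions.KMVSignedSecondGap
import Literature.NumberTheory.LFunctions.KMVAmplifiedDiagonalForms
import Literature.NumberTheory.LFunctions.KMVMomentAsymptoticsUniqueness
import Summits.Parity.GeneralizedHardyLittlewood.Theses.PrimeLevelFamEdge
import Summits.Parity.GeneralizedHardyLittlewood.Theorems.BeyondDiagonalBeatsQuarter.UpperSomewhereBand
import Summits.Parity.GeneralizedHardyLittlewood.Theorems.BeyondDiagonalBeatsQuarter.HeartIsolationOffDiag
import Summits.Parity.GeneralizedHardyLittlewood.Theorems.BeyondDiagonalBeatsQuarter.KernelFormXSq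
import Literature.NumberTheory.LFunctions.KowalskiMichelPeterssonFormulaHolds
import Summits.Parity.GeneralizedHardyLittlewood.Theorems.BeyondDiagonalBeatsQuarter.HeartOffDiag

/-!
# Line `diagonal-kernel-split` for the deciding crux K_B (`PrimeLevelFamEdge.BeyondDiagonalBeatsQuarter`)
# — RESHAPED skeleton (rev 4, lead `ls-Bfam-prover-1` g8/g9, 2026-08-28; STUB-PLAN Decision 1; rev 3 = Pt′ closed BY NAME;
# rev 4 = heart SHARPENED to the explicit off-diagonal `stub_offDiagBelowSlack_io`, H⁻_io,U closed modulo it by H4+H1)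

Namespace `Summit.Parity.GeneralizedHardyLittlewood.Cruxes.BeyondDiagonalBeatsQuarter.DiagonalKernelSplit`.
Card: `Cruxes/BeyondDiagonalBeatsQuarter/Lines/diagonal-kernel-split.md`; plan:
`Cruxes/BeyondDiagonalBeatsQuarter/STUB-PLAN-stub_kernelDiagonalUpperOnPrimeAverageXSq.md` (§0, §3, §5).

IDEA (unchanged). Beyond the diagonal the «diagonal-shape» main term `mainScale·secondMomentForm(Δ′,P,1)`
of KMV's second display is, at coefficient level, `2q̂·Σ_{m₁,m₂} x_{m₁}x_{m₂}K(m₁,m₂)` with the TYPED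
diagonal kernel `K = KMV2000.kmvKernel (log q̂)` ([KowalskiMichelVanderKam2000] (21)–(23)) and the KMV
profile weights `x_m = μ(m)ψ(m)⁻¹P(log(M/m)/log M)`. The q-FREE statement «kernel form at `X²` `=`
continued KMV main term for every mollifier length» is stub N (`stub_kernelFormXSq`, LANDED p602508 as
`Summit.Parity.GeneralizedHardyLittlewood.Theses.PrimeLevelFamEdge.stub_kernelFormXSq`; closed BY NAME
below). What is LEFT of K_B is the analytic heart.

RESHAPE (rev 2, STUB-PLAN Decision 1 = k=2 Plan 2, R0–R2). The rev-1 heart H⁻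
`stub_kernelDiagonalUpperOnPrimeAverageXSq` (`∀ ε > 0 ∃ N₀ ∀ N ≥ N₀`, signed average over the good
primes of every late dyadic block) is OVER-STRENGTH: k=2 Plan 1 / STUB-PLAN §8 type the chain
«H⁻ ⊢ `LOneLowerBoundOdd 4`» from tree facts (the `∀N`-form carries a duplicate of the (A)-atom that
the route draws from `MomentsBeyondDiagonal`, QUANTIFIER-LEDGER 47a8ef7f6f97672c row 2). It is replaced
by the WEAKEST shape the composition accepts — **H⁻_io,U** `stub_kernelExcessBelowSlack_io`: for `Δ′` in a
window `(1, b)` there is a FIXED tolerance `U < 4(Δ′−1)/Δ′` (the band slack of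
`upperSomewhere_X_sq_iff_T₂_band`) such that INFINITELY OFTEN along good primes `q` (pointwise, no block
average) the mollified second harmonic moment exceeds `2q̂ ×` its diagonal kernel form by at most
`U·mainScaleReal`. R0 (`kernelExcess_io_of_blockAverage` below): rev-1 H⁻ ⇒ H⁻_io,U, so nothing provable is
lost. R1 (`T₂_le_of_secondMomentUpperControl_io`, the i.o. twin of the tree's
`OffDiagonalUpperControl.T₂_le_of_secondMomentUpperControl` :205): under `MomentAsymptotics` the level-free
`T₂` is decided at ONE good prime beyond each threshold, so i.o. control pins `T₂(Δ′,X²,1) ≤ U`. R2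
(`BeyondDiagonalBeatsQuarter_of`): `T₂ ≤ U < slack` on `(1, min b Δ 2)` is the T₂-band, hence S2u
(`secondMomentForm_X_sq_add_lt_iff`), hence K_B by `beyondDiagonalBeatsQuarter_of_upperSomewhere_X_sq'`
(p532279; Cauchy–Schwarz floor from Pt′, `T₁ = 0` from the crux's Bettin antecedent). INTENDED ROUTE to the
heart (plan Ω): prove the block bound at CLEAN scales (`HMinusBlockAtCleanScales` of `Lines/critic_sketch.lean`)
and compose with the landed clean-scales pack `Theorems/BeyondDiagonalBeatsQuarter/CleanScales.lean`
(`cleanScales_io` = Landau–Page via `MontgomeryVaughan1975.exists_level_without_exceptionalZero`; block ⇒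
pointwise) — helpers, not stubs (shred lint; STUB-PLAN §5: H5–H8 are NOT registered before gates G1 ∧ G2).

STUBS: `stub_peterssonBound` (Pt′ — CLOSED BY NAME at rev 3 (lead g9, director K-PLFE-W2 10:29:11Z) by the tree
THEOREM `KowalskiMichel2000.kowalskiMichel2000_peterssonBound_holds`, `KowalskiMichelPeterssonFormulaHolds.lean`:
weight-2 Poincaré series by Hecke's trick + Weil; fact skeleton I1 of cell ls-inputs) · `stub_kernelFormXSq` (N,
CLOSED by name, p602508) · `stub_kernelExcessBelowSlack_io` (H⁻_io,U, the heart, XL — the ONLY open stub).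
`BeyondDiagonalBeatsQuarter_of` is a real proof. F2 (plan-Ω exponent window non-empty, lead g9):
`Theorems/BeyondDiagonalBeatsQuarter/OmegaWindow.lean` (`OmegaAdmissible`, `omegaWindow_nonempty` in the quantifier
order of `kernelExcessBelowSlack_io_of_blockAtCleanScales`; binding row = ABL's shift range `η + ε ≤ δ_ABL(ηV)`).
REV 4 (lead g9): helper H4 LANDED (`Theorems/BeyondDiagonalBeatsQuarter/PeterssonSplit*.lean`, p630487 p631080
p631641 p632323 p631998 p632742: `PeterssonSplit.QhPQ_X_sq_one_split` — for `q` prime, `1 ≤ M < q`,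
`Q^h(X²,1;M) = 2q̂·Σ xsq xsq·Corner.trueDiagKernel(q̂) − Σ (x_l l^{−1/2})(x_m m^{−1/2})·offDiag q l m`, `offDiag` the
EXPLICIT absolutely convergent Kloosterman–Bessel double series) and the reduction `HeartOffDiag.lean` (p633170:
`PeterssonSplit.kernelExcessBelowSlack_io_of_offDiag_io`, H4 + H1): the registered heart of rev 2–3 is now a
THEOREM modulo the sharper, explicit stub **`stub_offDiagBelowSlack_io`** (OFF_io,U): «∃ b > 1 ∀ Δ′ ∈ (1,b)
∃ U < 4(Δ′−1)/Δ′ ∀ q₀ ∃ good prime q ≥ q₀: −re Σ_{l,m ≤ q̂^{Δ′}} c_l c_m·offDiag q l m ≤ U·mainScaleReal Δ′ q»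
(`c_m = KMV2000.mollifierCoeff X² M m = x_m m^{−1/2}`). Equivalent content (the corner is o(ms), H1), explicit object:
plan Ω's Ω-d/Ω-e/Ω-f/Ω-g are the analysis of `offDiag`. REGISTERED STUBS after rev 4 = {`stub_offDiagBelowSlack_io`}.

LANDED HELPERS for the heart prover (all `Theorems/BeyondDiagonalBeatsQuarter/`, `--supports` this crux,
lead ls-Bfam-prover-1 g8, 2026-08-28): `KernelExcessIO.lean` (p619672: R0–R2 Theorems-side,
`beyondDiagonalBeatsQuarter_of_kernelExcess_io` closes K_B from Pt′ + N + this heart BY NAME);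
`CleanScales.lean` (p620004, H1′: `CleanScale`, `cleanScales_io` (Landau–Page), `kernelExcess`,
`kernelExcessBelowSlack_io_of_blockAtCleanScales` — block bound at clean scales ⇒ this heart verbatim);
H1 (`CornerNegligibleXSq`, STUB-PLAN §1.3(a)/§7): `CornerWeight/CornerWeightE/CornerMoebius/CornerReduction/
CornerAbel/CornerSums/CornerAssembly/CornerNegligibleXSq.lean` (p621633, p622074, p622004, p622893, p623028,
p623582, p624184, p624812): `Corner.trueDiagKernel` (true Petersson diagonal kernel, weight
`𝒲(y) = ∫_0^∞ dv/(e^{v+y/v} − 1)`), `Corner.trueDiagKernel_sub_kmvKernel`, `Corner.abs_corner_le`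
(`|Σ xx (K_true(Q) − kmvKernel(log Q))| ≤ C/log³M` for `2 ≤ M ≤ Q^{2−κ}`) and `Corner.cornerNegligibleXSq`
(q̂-form, `1 < Δ′ < 2`). Plan Ω's H4–H8 (exact Petersson split; localisation; `c_zero`; large/small moduli)
remain behind the planner gates G1 ∧ G2 (STUB-PLAN §4.5); no prover act on them before the gates pass.
FRAMING (cell rule): the programme SEARCHES and TYPES; nothing here is a claim about Landau–Siegel zeros.
-/

noncomputable section

open Finset Polynomial
open scoped Real

namespace Summit.Parity.GeneralizedHardyLittlewood.Cruxes.BeyondDiagonalBeatsQuarter.DiagonalKernelSplit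

open Literature.NumberTheory.LFunctions
open Literature.NumberTheory.LFunctions.KMV2000
open Summit.Parity.GeneralizedHardyLittlewood.Theorems.BeyondDiagonalBeatsQuarter

/-! ## Registered stubs -/

/-- **Pt′ (fact binder, = route support `PeterssonBoundPrinted`) — CLOSED BY NAME (rev 3).** The printed
in-range Petersson bound at prime level [KowalskiMichel2000 (23) p. 312 / IwaniecKowalski2004 Cor. 14.24]; enters
only through the Cauchy–Schwarz floor `0 < second + T₂` inside `beyondDiagonalBeatsQuarter_of_upperSomewhere_X_sq'`.
A THEOREM of the tree since the ls-inputs I1 chain landed: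
`Literature.NumberTheory.LFunctions.KowalskiMichel2000.kowalskiMichel2000_peterssonBound_holds`
(`KowalskiMichelPeterssonFormulaHolds.lean`: Poincaré series by Hecke's trick, `L²` step, prime-level Parseval,
Weil's bound). [cite: KowalskiMichel2000, §2.4.2 p. 312 (23)] -/
theorem stub_peterssonBound : KowalskiMichel2000.kowalskiMichel2000_peterssonBound :=
  KowalskiMichel2000.kowalskiMichel2000_peterssonBound_holds

/-- **N (LANDED p602508; q-free arithmetic).** The KMV diagonal kernel form at the `X²` profile equals the
continued KMV main term, uniformly in the affine level-parameter `L ∈ [0, log M]`: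
`Σ_{m₁,m₂ ≤ M} x_{m₁}x_{m₂}·kmvKernel L m₁ m₂ = 4ζ(2)²·(L/log M + 1)/log²M + O(1/log³M)`,
`x_m = μ(m)ψ(m)⁻¹(log(M/m)/log M)²`. Closed BY NAME by the landed
`Summit.Parity.GeneralizedHardyLittlewood.Theses.PrimeLevelFamEdge.stub_kernelFormXSq`
(`Theorems/BeyondDiagonalBeatsQuarter/KernelFormXSq.lean`, ls-Bfam-prover-1 g7; W1 second read evidence #30).
[KowalskiMichelVanderKam2000 (21)–(23), Prop. 5.1 (31) p. 19.] -/
theorem stub_kernelFormXSq :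
    ∃ C M₀ : ℝ, ∀ M : ℝ, M₀ ≤ M → ∀ L : ℝ, 0 ≤ L → L ≤ Real.log M →
      |(∑ m₁ ∈ Icc 1 ⌊M⌋₊, ∑ m₂ ∈ Icc 1 ⌊M⌋₊,
          ((ArithmeticFunction.moebius m₁ : ℝ) *
              ((KMV2000.psi m₁)⁻¹ * (X ^ 2 : ℝ[X]).eval (Real.log (M / m₁) / Real.log M))) *
            ((ArithmeticFunction.moebius m₂ : ℝ) *
              ((KMV2000.psi m₂)⁻¹ * (X ^ 2 : ℝ[X]).eval (Real.log (M / m₂) / Real.log M))) *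
            KMV2000.kmvKernel L m₁ m₂) -
        4 * (π ^ 2 / 6) ^ 2 * (L / Real.log M + 1) / Real.log M ^ 2| ≤ C / Real.log M ^ 3 :=
  Summit.Parity.GeneralizedHardyLittlewood.Theses.PrimeLevelFamEdge.stub_kernelFormXSq

/-- **OFF_io,U (the heart from rev 4 on, XL; explicit).** For `Δ′` in some window `(1, b)` there is a tolerance
`U < 4(Δ′−1)/Δ′` such that beyond every threshold `q₀` there is a good prime `q` (`q̂^{Δ′} ∉ ℕ`) at which
minus the real part of the mollified OFF-DIAGONAL
`Σ_{l,m ≤ M} (x_l l^{−1/2})(x_m m^{−1/2})·OFF_q(l,m)`, `M = q̂^{Δ′}`,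
`OFF_q(l,m) = 2q̂ Σ_{(n₁,n₂)} (n₁n₂)^{−1/2}W(n₁n₂/q̂²) Σ_{d₁∣(l,n₁)} Σ_{d₂∣(m,n₂)} J_q(l n₁/d₁², m n₂/d₂²)`
(`PeterssonSplit.offDiag`, the explicit absolutely convergent Kloosterman–Bessel double series of KMV (21)–(23) ⊗
Lemma 3.1 ⊗ Petersson at prime level; `J_q = KowalskiMichel2000.petJ`), is at most `U·mainScaleReal Δ′ q`.
By `PeterssonSplit.kernelExcessBelowSlack_io_of_offDiag_io` (H4 exact split + H1 corner, p633170) it implies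
the rev-2/3 heart H⁻_io,U verbatim (below, now a theorem); conversely H⁻_io,U gives it back up to the o(ms)
corner — same content, explicit object. NOT IN PRINT at prime level; plan Ω (STUB-PLAN §4): Ω-d localisation
(double Poisson in `n₁, n₂` mod `cq`), Ω-e q-free main terms (= 0 at clean scales, GATE G1), Ω-f dispersion
over the prime moduli (ABL Prop. 4.1 + H7b, exponent window `OmegaWindow.lean`), Ω-g small conductors at
`(a₀, η′)`-clean scales (`CleanScales.lean`); tools landed: C1 `MellinBump.mellinBump_xsq(_bv)`, C2
`MellinBumpPeriodic`. Why it might still fail: an η-free resonance floor at clean scales (then use the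
pointwise clean-scale composition, p629983) or no printed power saving uniform in the shift family (G2 (c)).
[cite: KowalskiMichelVanderKam2000, (21)–(23) p. 12–13, Lemma 3.3 p. 9 (the off-diagonal terms)] -/
theorem stub_offDiagBelowSlack_io :
    ∃ b : ℝ, 1 < b ∧ ∀ Δ' : ℝ, 1 < Δ' → Δ' < b → ∃ U : ℝ, U < 4 * (Δ' - 1) / Δ' ∧
      ∀ q₀ : ℕ, ∃ q : ℕ, ∃ _ : NeZero q, q₀ ≤ q ∧ q.Prime ∧
        (∀ n : ℕ, (n : ℝ) ≠ KMV2000.qhat q ^ Δ') ∧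
          -(∑ l ∈ Icc 1 ⌊KMV2000.qhat q ^ Δ'⌋₊, ∑ m ∈ Icc 1 ⌊KMV2000.qhat q ^ Δ'⌋₊,
              ((KMV2000.mollifierCoeff (X ^ 2) (KMV2000.qhat q ^ Δ') l *
                  KMV2000.mollifierCoeff (X ^ 2) (KMV2000.qhat q ^ Δ') m : ℝ) : ℂ) *
                PeterssonSplit.offDiag q l m).re ≤
            U * KMV2000.mainScaleReal Δ' q := by
  sorry

/-- **H⁻_io,U (the heart of rev 2–3; from rev 4 a THEOREM modulo `stub_offDiagBelowSlack_io`).** For `Δ′`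
in some window `(1, b)` there is a tolerance `U < 4(Δ′−1)/Δ′` such that beyond every threshold `q₀`
there is a good prime `q` (`q̂^{Δ′} ∉ ℕ`) at which the mollified second harmonic moment
`Q^h(X², 1; q̂^{Δ′})` exceeds `2q̂ ×` its diagonal kernel form by at most `U·mainScaleReal Δ′ q`.
STUB-PLAN Decision 1 (k=2 Plan 2): strictly weaker than the rev-1 block/`∀ε∀N` heart (R0), composes
identically (R1/R2), and — unlike every `∀N`/`ε` shape — is not caught by the (A)-forcing of STUB-PLAN §8
(its witnesses may sit at Landau–Page-clean scales, which recur: `CleanScales.lean`). NOT IN PRINT at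
prime level (nearest print: the all-level average of [IwaniecSarnak2000] / [Conversations §7 p. 97]);
plan Ω (STUB-PLAN §4) behind paper gates G1 (`c_zero < slack`) and G2 (dispersion shape ledger).
Why it might still fail: G1 (a positive q-free dual-diagonal constant `≥` slack on every `(1,b)`) or G2
(no printed power-saving input uniform in the shift family). -/
theorem stub_kernelExcessBelowSlack_io :
    ∃ b : ℝ, 1 < b ∧ ∀ Δ' : ℝ, 1 < Δ' → Δ' < b → ∃ U : ℝ, U < 4 * (Δ' - 1) / Δ' ∧
      ∀ q₀ : ℕ, ∃ q : ℕ, ∃ _ : NeZero q, q₀ ≤ q ∧ q.Prime ∧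
        (∀ n : ℕ, (n : ℝ) ≠ KMV2000.qhat q ^ Δ') ∧
          (KMV2000.QhPQ q (X ^ 2) 1 (KMV2000.qhat q ^ Δ')).re -
              2 * KMV2000.qhat q *
                ∑ m₁ ∈ Icc 1 ⌊KMV2000.qhat q ^ Δ'⌋₊, ∑ m₂ ∈ Icc 1 ⌊KMV2000.qhat q ^ Δ'⌋₊,
                  ((ArithmeticFunction.moebius m₁ : ℝ) *
                      ((KMV2000.psi m₁)⁻¹ * (X ^ 2 : ℝ[X]).eval
                        (Real.log (KMV2000.qhat q ^ Δ' / m₁) / Real.log (KMV2000.qhat q ^ Δ')))) *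
                    ((ArithmeticFunction.moebius m₂ : ℝ) *
                      ((KMV2000.psi m₂)⁻¹ * (X ^ 2 : ℝ[X]).eval
                        (Real.log (KMV2000.qhat q ^ Δ' / m₂) / Real.log (KMV2000.qhat q ^ Δ')))) *
                    KMV2000.kmvKernel (Real.log (KMV2000.qhat q)) m₁ m₂ ≤
            U * KMV2000.mainScaleReal Δ' q :=
  PeterssonSplit.kernelExcessBelowSlack_io_of_offDiag_io stub_offDiagBelowSlack_io

/-! ## Composition (real proofs) -/

/-- The kernel form of `stub_kernelFormXSq` at general `(M, L)` (a local abbreviation for the proofs below;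
it does not occur in any stub signature). -/
def kernelFormXSq (M L : ℝ) : ℝ :=
  ∑ m₁ ∈ Icc 1 ⌊M⌋₊, ∑ m₂ ∈ Icc 1 ⌊M⌋₊,
    ((ArithmeticFunction.moebius m₁ : ℝ) *
        ((KMV2000.psi m₁)⁻¹ * (X ^ 2 : ℝ[X]).eval (Real.log (M / m₁) / Real.log M))) *
      ((ArithmeticFunction.moebius m₂ : ℝ) *
        ((KMV2000.psi m₂)⁻¹ * (X ^ 2 : ℝ[X]).eval (Real.log (M / m₂) / Real.log M))) *
      KMV2000.kmvKernel L m₁ m₂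

/-- **R0 (the reshape is a weakening).** The rev-1 heart H⁻ (signed block average, `∀ ε ∀ N ≥ N₀`,
verbatim :93–108 of rev 1) implies H⁻_io,U with `U = 2(Δ′−1)/Δ′` (half the slack): an average `≤ U·Σms`
over a non-empty block has a term `≤ U·ms_q`, and blocks holding good primes recur
(`KMV2000.exists_goodPrimes_nonempty`, `goodPrimesUnbounded_of_lt_two`). So nothing provable is lost. -/
theorem kernelExcess_io_of_blockAverage
    (hH : ∃ b : ℝ, 1 < b ∧ ∀ Δ' : ℝ, 1 < Δ' → Δ' < b → ∀ ε : ℝ, 0 < ε → ∃ N₀ : ℕ, ∀ N : ℕ, N₀ ≤ N →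
      (∑ q ∈ KMV2000.goodPrimes Δ' N,
          ((if hq : q = 0 then (0 : ℂ) else
              (haveI : NeZero q := ⟨hq⟩; KMV2000.QhPQ q (X ^ 2) 1 (KMV2000.qhat q ^ Δ'))) -
            ((2 * KMV2000.qhat q *
                ∑ m₁ ∈ Icc 1 ⌊KMV2000.qhat q ^ Δ'⌋₊, ∑ m₂ ∈ Icc 1 ⌊KMV2000.qhat q ^ Δ'⌋₊,
                  ((ArithmeticFunction.moebius m₁ : ℝ) *
                      ((KMV2000.psi m₁)⁻¹ * (X ^ 2 : ℝ[X]).eval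
                        (Real.log (KMV2000.qhat q ^ Δ' / m₁) / Real.log (KMV2000.qhat q ^ Δ')))) *
                    ((ArithmeticFunction.moebius m₂ : ℝ) *
                      ((KMV2000.psi m₂)⁻¹ * (X ^ 2 : ℝ[X]).eval
                        (Real.log (KMV2000.qhat q ^ Δ' / m₂) / Real.log (KMV2000.qhat q ^ Δ')))) *
                    KMV2000.kmvKernel (Real.log (KMV2000.qhat q)) m₁ m₂ : ℝ) : ℂ))).re ≤
        ε * ∑ q ∈ KMV2000.goodPrimes Δ' N, KMV2000.mainScaleReal Δ' q) :
    ∃ b : ℝ, 1 < b ∧ ∀ Δ' : ℝ, 1 < Δ' → Δ' < b → ∃ U : ℝ, U < 4 * (Δ' - 1) / Δ' ∧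
      ∀ q₀ : ℕ, ∃ q : ℕ, ∃ _ : NeZero q, q₀ ≤ q ∧ q.Prime ∧
        (∀ n : ℕ, (n : ℝ) ≠ KMV2000.qhat q ^ Δ') ∧
          (KMV2000.QhPQ q (X ^ 2) 1 (KMV2000.qhat q ^ Δ')).re -
              2 * KMV2000.qhat q * kernelFormXSq (KMV2000.qhat q ^ Δ') (Real.log (KMV2000.qhat q)) ≤
            U * KMV2000.mainScaleReal Δ' q := by
  obtain ⟨b, hb, hH⟩ := hH
  refine ⟨min b 2, lt_min hb (by norm_num), fun Δ' h1 h2 ↦ ?_⟩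
  have hΔ'b : Δ' < b := lt_of_lt_of_le h2 (min_le_left _ _)
  have hΔ'2 : Δ' < 2 := lt_of_lt_of_le h2 (min_le_right _ _)
  have hΔ'0 : 0 < Δ' := by linarith
  set U : ℝ := 2 * (Δ' - 1) / Δ' with hU_def
  have hUpos : 0 < U := by rw [hU_def]; exact div_pos (by linarith) hΔ'0
  have hUslack : U < 4 * (Δ' - 1) / Δ' := by
    rw [hU_def]; exact div_lt_div_of_pos_right (by linarith) hΔ'0
  refine ⟨U, hUslack, fun q₀ ↦ ?_⟩
  obtain ⟨N₀, hN₀⟩ := hH Δ' h1 hΔ'b U hUpos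
  obtain ⟨N, hNge, hNne⟩ :=
    KMV2000.exists_goodPrimes_nonempty (KMV2000.goodPrimesUnbounded_of_lt_two hΔ'0 hΔ'2) (max N₀ q₀)
  have hblock := hN₀ N (le_trans (le_max_left _ _) hNge)
  rw [Complex.re_sum, Finset.mul_sum] at hblock
  obtain ⟨q, hqmem, hqle⟩ := Finset.exists_le_of_sum_le hNne hblock
  obtain ⟨hqN, -, hqp, hqg⟩ := KMV2000.mem_goodPrimes_iff.mp hqmem
  haveI : NeZero q := ⟨hqp.ne_zero⟩
  refine ⟨q, inferInstance, ?_, hqp, fun n ↦ by simpa [KMV2000.qhat] using hqg n, ?_⟩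
  · have := le_trans (le_max_right _ _) hNge
    omega
  · rw [dif_neg hqp.ne_zero] at hqle
    simpa only [Complex.sub_re, Complex.ofReal_re, kernelFormXSq] using hqle

/-- **R1 (i.o. twin of `OffDiagonalUpperControl.T₂_le_of_secondMomentUpperControl`).** If the KMV moment
asymptotics hold on a window with extra main terms `(T₁, T₂)` and, at an admissible `P`, an even-or-odd
`Q` and a length `Δ' ∈ (Δlo, Δhi]`, `Δ' > 0`, the upper control
`re Q^h(P,Q; q̂^{Δ'}) ≤ 2ζ(2)² q̂/(Δ'² log² q̂)·(second(Δ',P,Q) + U) + C q̂ log⁻³ q̂` holds at good primes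
beyond every threshold (INFINITELY OFTEN — the i.o. hypothesis supplies the prime; no
`GoodPrimesUnbounded` needed), then `T₂ Δ' P Q ≤ U`: `T₂` is level-free, so ONE good prime beyond
`max q₀ N` decides it. Proof = the tree's :205 proof with `hctl` supplying the prime.
[cite: KowalskiMichelVanderKam2000, §6 p. 19 (shape of the second-moment display), §2 p. 7 (M ∉ ℤ)] -/
theorem T₂_le_of_secondMomentUpperControl_io {Δlo Δhi : ℝ} {T₁ T₂ : ℝ → ℝ[X] → ℝ[X] → ℝ}
    (hMA : MomentAsymptotics Δlo Δhi T₁ T₂) {P Q : ℝ[X]} (hP : Admissible P)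
    (hQ : IsEvenOrOdd Q) {Δ' : ℝ} (h1 : Δlo < Δ') (h2 : Δ' ≤ Δhi) (hΔ' : 0 < Δ') {U C : ℝ}
    (hctl : ∀ q₁ : ℕ, ∃ q : ℕ, ∃ _ : NeZero q, q₁ ≤ q ∧ q.Prime ∧
      (∀ n : ℕ, (n : ℝ) ≠ qhat q ^ Δ') ∧
        (QhPQ q P Q (qhat q ^ Δ')).re ≤
          2 * (π ^ 2 / 6) ^ 2 * (qhat q / (Δ' ^ 2 * Real.log (qhat q) ^ 2)) *
              (secondMomentForm Δ' P Q + U) +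
            C * qhat q * (Real.log (qhat q))⁻¹ ^ 3) :
    T₂ Δ' P Q ≤ U := by
  by_contra hle
  have hlt : U < T₂ Δ' P Q := lt_of_not_ge hle
  obtain ⟨C₂, q₀, H⟩ := hMA P Q hP hQ Δ' h1 h2
  set δ : ℝ := T₂ Δ' P Q - U with hδ
  have hδpos : 0 < δ := by rw [hδ]; linarith
  set z : ℝ := 2 * (π ^ 2 / 6) ^ 2 with hz
  have hzpos : 0 < z := by rw [hz]; positivity
  have hZ : (2 * riemannZeta 2 ^ 2 : ℂ) = ((z : ℝ) : ℂ) := by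
    rw [riemannZeta_two, hz]; push_cast; ring
  set B : ℝ := (|C| + |C₂|) * Δ' ^ 2 / (z * δ) + 1 with hB
  obtain ⟨N, hN⟩ := exists_log_qhat_ge B
  obtain ⟨q, inst, hqge, hq, hgoodq, b0⟩ := hctl (max q₀ N)
  have hq0 : q₀ ≤ q := le_trans (le_max_left _ _) hqge
  have hqN : N ≤ q := le_trans (le_max_right _ _) hqge
  have hlg : B ≤ Real.log (qhat q) := hN q hqN
  have hB1 : 1 ≤ B := by
    have : 0 ≤ (|C| + |C₂|) * Δ' ^ 2 / (z * δ) := by positivity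
    rw [hB]; linarith
  have hlgpos : 0 < Real.log (qhat q) := by linarith
  have hqhatpos : 0 < qhat q := by
    unfold qhat
    have : 0 < (q : ℝ) := by exact_mod_cast hq.pos
    positivity
  obtain ⟨-, b1⟩ := H q hq hq0 hgoodq
  set R : ℝ := (QhPQ q P Q (qhat q ^ Δ')).re with hR
  set r : ℝ := qhat q / (Δ' ^ 2 * Real.log (qhat q) ^ 2) with hr
  have hrpos : 0 < r := by rw [hr]; positivity
  have hs3 : 0 ≤ qhat q * (Real.log (qhat q))⁻¹ ^ 3 := by positivity
  -- MA: |R − z r (second + T₂)| ≤ |C₂| q̂ log⁻³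
  have hb1 : z * r * (secondMomentForm Δ' P Q + T₂ Δ' P Q) -
      |C₂| * qhat q * (Real.log (qhat q))⁻¹ ^ 3 ≤ R := by
    have e : (2 * riemannZeta 2 ^ 2 * ((r : ℝ) : ℂ)) *
        ((secondMomentForm Δ' P Q + T₂ Δ' P Q : ℝ) : ℂ) =
        ((z * r * (secondMomentForm Δ' P Q + T₂ Δ' P Q) : ℝ) : ℂ) := by
      rw [hZ]; push_cast; ring
    rw [e] at b1
    have h' := (Complex.abs_re_le_norm _).trans b1
    rw [Complex.sub_re, Complex.ofReal_re, ← hR] at h'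
    have hC : C₂ * qhat q * (Real.log (qhat q))⁻¹ ^ 3 ≤ |C₂| * qhat q * (Real.log (qhat q))⁻¹ ^ 3 := by
      rw [mul_assoc, mul_assoc]
      exact mul_le_mul_of_nonneg_right (le_abs_self C₂) hs3
    have := (abs_le.1 (h'.trans hC)).1
    linarith
  -- control: R ≤ z r (second + U) + |C| q̂ log⁻³
  have hb0 : R ≤ z * r * (secondMomentForm Δ' P Q + U) + |C| * qhat q * (Real.log (qhat q))⁻¹ ^ 3 := by
    have hC : C * qhat q * (Real.log (qhat q))⁻¹ ^ 3 ≤ |C| * qhat q * (Real.log (qhat q))⁻¹ ^ 3 := by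
      rw [mul_assoc, mul_assoc]
      exact mul_le_mul_of_nonneg_right (le_abs_self C) hs3
    linarith [b0, hC]
  have key : z * r * δ ≤ (|C| + |C₂|) * qhat q * (Real.log (qhat q))⁻¹ ^ 3 := by
    have e : z * r * δ = z * r * (secondMomentForm Δ' P Q + T₂ Δ' P Q) -
        z * r * (secondMomentForm Δ' P Q + U) := by rw [hδ]; ring
    rw [e]; linarith
  have key2 : z * δ * Real.log (qhat q) ≤ (|C| + |C₂|) * Δ' ^ 2 := by
    rw [hr] at key
    have e1 : z * (qhat q / (Δ' ^ 2 * Real.log (qhat q) ^ 2)) * δ =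
        (z * δ * Real.log (qhat q)) * (qhat q / (Δ' ^ 2 * Real.log (qhat q) ^ 3)) := by
      field_simp
    have e2 : (|C| + |C₂|) * qhat q * (Real.log (qhat q))⁻¹ ^ 3 =
        ((|C| + |C₂|) * Δ' ^ 2) * (qhat q / (Δ' ^ 2 * Real.log (qhat q) ^ 3)) := by
      field_simp
    rw [e1, e2] at key
    have hw : 0 < qhat q / (Δ' ^ 2 * Real.log (qhat q) ^ 3) := by positivity
    exact le_of_mul_le_mul_right key hw
  have hzd : 0 < z * δ := mul_pos hzpos hδpos
  have key3 : z * δ * B ≤ (|C| + |C₂|) * Δ' ^ 2 :=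
    le_trans (mul_le_mul_of_nonneg_left hlg hzd.le) key2
  rw [hB] at key3
  have e3 : z * δ * ((|C| + |C₂|) * Δ' ^ 2 / (z * δ) + 1) = (|C| + |C₂|) * Δ' ^ 2 + z * δ := by
    field_simp
  rw [e3] at key3
  linarith

/-- Specialisation of q-free kernel asymptotics `KF(M, L) = 4ζ(2)²(L/log M + 1)/log²M + O(log⁻³M)` to
`M = q̂^{Δ′}`, `L = log q̂`, `Δ′ ≥ 1`: `|2q̂·KF − mainScaleReal·secondMomentForm(Δ′,X²,1)| ≤ δ·mainScaleReal`
for `q ≥ q₀(Δ′,δ)` (stated for an abstract kernel form `KF`; used with `KF = kernelFormXSq`). -/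
theorem kernelMainTerm_eventually {KF : ℝ → ℝ → ℝ} {C M₀ : ℝ}
    (hN : ∀ M : ℝ, M₀ ≤ M → ∀ L : ℝ, 0 ≤ L → L ≤ Real.log M →
      |KF M L - 4 * (π ^ 2 / 6) ^ 2 * (L / Real.log M + 1) / Real.log M ^ 2| ≤ C / Real.log M ^ 3)
    {Δ' : ℝ} (h1 : 1 ≤ Δ') {δ : ℝ} (hδ : 0 < δ) :
    ∃ q₀ : ℕ, ∀ q : ℕ, q₀ ≤ q →
      |2 * qhat q * KF (qhat q ^ Δ') (Real.log (qhat q)) -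
          mainScaleReal Δ' q * secondMomentForm Δ' (X ^ 2) 1| ≤ δ * mainScaleReal Δ' q := by
  -- thresholds: q ≥ 40 (so q̂ > 1), q̂ ≥ M₀ (so q̂^{Δ'} ≥ M₀), log q̂ ≥ K := C / (δ (π²/6)² Δ')
  set ζ2 : ℝ := π ^ 2 / 6 with hζ2
  have hζ2pos : 0 < ζ2 := by positivity
  set K : ℝ := C / (δ * ζ2 ^ 2 * Δ') with hK
  set T : ℝ := max (max M₀ 1) (Real.exp K) with hT
  refine ⟨max 40 ⌈(2 * π * T) ^ 2⌉₊, fun q hq ↦ ?_⟩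
  have hq40 : 40 ≤ q := le_of_max_le_left hq
  have hqT : ⌈(2 * π * T) ^ 2⌉₊ ≤ q := le_of_max_le_right hq
  set s : ℝ := qhat q with hs
  have hs1 : 1 < s := one_lt_qhat hq40
  have hs0 : 0 < s := lt_trans one_pos hs1
  have hlog0 : 0 < Real.log s := Real.log_pos hs1
  have hsT : T ≤ s := by
    have hqR : (2 * π * T) ^ 2 ≤ (q : ℝ) := (Nat.le_ceil _).trans (by exact_mod_cast hqT)
    have h2π : 0 < 2 * π := by positivity
    have hT0 : 0 ≤ T := le_trans zero_le_one ((le_max_right _ _).trans (le_max_left _ _))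
    have hsq : 2 * π * T ≤ Real.sqrt q := by
      rw [show (2 * π * T : ℝ) = Real.sqrt ((2 * π * T) ^ 2) by rw [Real.sqrt_sq (by positivity)]]
      exact Real.sqrt_le_sqrt hqR
    rw [hs, qhat, le_div_iff₀ h2π]
    linarith
  have hsM₀ : M₀ ≤ s := le_trans ((le_max_left _ _).trans (le_max_left _ _)) hsT
  have hsK : K ≤ Real.log s := by
    have : Real.exp K ≤ s := (le_max_right _ _).trans hsT
    simpa [Real.log_exp] using Real.log_le_log (Real.exp_pos K) this
  have hM : Real.log (s ^ Δ') = Δ' * Real.log s := Real.log_rpow hs0 Δ'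
  have hsM : s ≤ s ^ Δ' := by
    simpa [Real.rpow_one] using Real.rpow_le_rpow_of_exponent_le hs1.le h1
  have hMM₀ : M₀ ≤ s ^ Δ' := hsM₀.trans hsM
  have hΔ0 : 0 < Δ' := lt_of_lt_of_le one_pos h1
  have hL1 : Real.log s ≤ Real.log (s ^ Δ') := by rw [hM]; nlinarith
  have key := hN (s ^ Δ') hMM₀ (Real.log s) hlog0.le hL1
  rw [hM] at key
  have hms : mainScaleReal Δ' q = 2 * ζ2 ^ 2 * (s / (Δ' ^ 2 * Real.log s ^ 2)) := by
    simp only [mainScaleReal, hs, qhat, hζ2]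
  have hsec : secondMomentForm Δ' (X ^ 2) 1 = 4 + 4 / Δ' := secondMomentForm_X_sq_one Δ'
  have hlogne : Real.log s ≠ 0 := hlog0.ne'
  have hΔne : Δ' ≠ 0 := hΔ0.ne'
  have hmain : 2 * s * (4 * ζ2 ^ 2 * (Real.log s / (Δ' * Real.log s) + 1) / (Δ' * Real.log s) ^ 2) =
      mainScaleReal Δ' q * secondMomentForm Δ' (X ^ 2) 1 := by
    rw [hms, hsec]; field_simp; ring
  have herr : 2 * s * (C / (Δ' * Real.log s) ^ 3) ≤ δ * mainScaleReal Δ' q := by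
    rw [hms]
    have hC : C ≤ δ * ζ2 ^ 2 * Δ' * Real.log s := by
      have hden : 0 < δ * ζ2 ^ 2 * Δ' := by positivity
      have := (div_le_iff₀' hden).mp (hK ▸ hsK : C / (δ * ζ2 ^ 2 * Δ') ≤ Real.log s)
      linarith
    rw [show 2 * s * (C / (Δ' * Real.log s) ^ 3) = C * (2 * s / (Δ' ^ 3 * Real.log s ^ 3)) by
      field_simp]
    rw [show δ * (2 * ζ2 ^ 2 * (s / (Δ' ^ 2 * Real.log s ^ 2))) =
        (δ * ζ2 ^ 2 * Δ' * Real.log s) * (2 * s / (Δ' ^ 3 * Real.log s ^ 3)) by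
      field_simp]
    exact mul_le_mul_of_nonneg_right hC (by positivity)
  have h2s : 0 < 2 * s := by positivity
  calc |2 * s * KF (s ^ Δ') (Real.log s) - mainScaleReal Δ' q * secondMomentForm Δ' (X ^ 2) 1|
      = |2 * s * (KF (s ^ Δ') (Real.log s) -
          4 * ζ2 ^ 2 * (Real.log s / (Δ' * Real.log s) + 1) / (Δ' * Real.log s) ^ 2)| := by
        rw [← hmain]; ring_nf
    _ = 2 * s * |KF (s ^ Δ') (Real.log s) -
          4 * ζ2 ^ 2 * (Real.log s / (Δ' * Real.log s) + 1) / (Δ' * Real.log s) ^ 2| := by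
        rw [abs_mul, abs_of_pos h2s]
    _ ≤ 2 * s * (C / (Δ' * Real.log s) ^ 3) := mul_le_mul_of_nonneg_left key h2s.le
    _ ≤ δ * mainScaleReal Δ' q := herr

/-- **R1 in kernel currency: N + H⁻_io,U at one length pin `T₂ ≤ U`.** Under `MomentAsymptotics` on a
window containing `Δ' ≥ 1`, if a kernel form `KF` has the q-free asymptotics of stub N and
`re Q^h(X²,1;q̂^{Δ'}) − 2q̂·KF(q̂^{Δ'}, log q̂) ≤ U·mainScaleReal` at good primes beyond every threshold,
then `T₂ Δ' X² 1 ≤ U` (for every `δ > 0`, N gives `2q̂·KF ≤ (second + δ)·mainScaleReal` eventually, so R1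
yields `T₂ ≤ U + δ`). [cite: KowalskiMichelVanderKam2000, §6 p. 19; Prop. 5.1 (31)] -/
theorem T₂_le_of_kernelExcess_io {Δlo Δhi : ℝ} {T₁ T₂ : ℝ → ℝ[X] → ℝ[X] → ℝ}
    (hMA : MomentAsymptotics Δlo Δhi T₁ T₂) {Δ' : ℝ} (h1 : Δlo < Δ') (h2 : Δ' ≤ Δhi) (hΔ'1 : 1 ≤ Δ')
    {KF : ℝ → ℝ → ℝ} {C M₀ : ℝ}
    (hN : ∀ M : ℝ, M₀ ≤ M → ∀ L : ℝ, 0 ≤ L → L ≤ Real.log M →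
      |KF M L - 4 * (π ^ 2 / 6) ^ 2 * (L / Real.log M + 1) / Real.log M ^ 2| ≤ C / Real.log M ^ 3)
    {U : ℝ}
    (hio : ∀ q₀ : ℕ, ∃ q : ℕ, ∃ _ : NeZero q, q₀ ≤ q ∧ q.Prime ∧
      (∀ n : ℕ, (n : ℝ) ≠ qhat q ^ Δ') ∧
        (QhPQ q (X ^ 2) 1 (qhat q ^ Δ')).re - 2 * qhat q * KF (qhat q ^ Δ') (Real.log (qhat q)) ≤
          U * mainScaleReal Δ' q) :
    T₂ Δ' (X ^ 2) 1 ≤ U := by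
  have hΔ'0 : 0 < Δ' := lt_of_lt_of_le one_pos hΔ'1
  refine le_of_forall_pos_lt_add fun δ hδ ↦ ?_
  have hδ2 : 0 < δ / 2 := by positivity
  obtain ⟨q₁, hq₁⟩ := kernelMainTerm_eventually hN hΔ'1 hδ2
  have hT : T₂ Δ' (X ^ 2) 1 ≤ U + δ / 2 := by
    refine T₂_le_of_secondMomentUpperControl_io hMA admissible_X_sq isEvenOrOdd_one h1 h2 hΔ'0
      (U := U + δ / 2) (C := 0) fun q₂ ↦ ?_
    obtain ⟨q, inst, hqge, hq, hg, hle⟩ := hio (max q₁ q₂)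
    refine ⟨q, inst, le_trans (le_max_right _ _) hqge, hq, hg, ?_⟩
    have hK := hq₁ q (le_trans (le_max_left _ _) hqge)
    have hms : mainScaleReal Δ' q = 2 * (π ^ 2 / 6) ^ 2 * (qhat q / (Δ' ^ 2 * Real.log (qhat q) ^ 2)) := by
      simp only [mainScaleReal, qhat]
    have hK' := (abs_le.1 hK).2
    rw [← hms]
    nlinarith [mainScaleReal_nonneg Δ' q]
  linarith

/-- **R2 (first half): N + H⁻_io,U ⇒ S2u.** For every window `(1, Δ]` and every MA-consistent `(T₁, T₂)`,
on the sub-window `(1, min b (min Δ 2))` the heart gives `T₂ Δ' X² 1 ≤ U < 4(Δ'−1)/Δ'`, i.e. the T₂-band,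
i.e. `second + T₂ < 2·lin²` at `X²` (`secondMomentForm_X_sq_add_lt_iff`). No Petersson input.
[cite: KowalskiMichelVanderKam2000, Thm. 6.1 (30)–(32), §6 p. 19] -/
theorem upperSomewhere_X_sq_of_kernelExcess_io {KF : ℝ → ℝ → ℝ} {C M₀ : ℝ}
    (hN : ∀ M : ℝ, M₀ ≤ M → ∀ L : ℝ, 0 ≤ L → L ≤ Real.log M →
      |KF M L - 4 * (π ^ 2 / 6) ^ 2 * (L / Real.log M + 1) / Real.log M ^ 2| ≤ C / Real.log M ^ 3)
    (hIO : ∃ b : ℝ, 1 < b ∧ ∀ Δ' : ℝ, 1 < Δ' → Δ' < b → ∃ U : ℝ, U < 4 * (Δ' - 1) / Δ' ∧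
      ∀ q₀ : ℕ, ∃ q : ℕ, ∃ _ : NeZero q, q₀ ≤ q ∧ q.Prime ∧
        (∀ n : ℕ, (n : ℝ) ≠ qhat q ^ Δ') ∧
          (QhPQ q (X ^ 2) 1 (qhat q ^ Δ')).re - 2 * qhat q * KF (qhat q ^ Δ') (Real.log (qhat q)) ≤
            U * mainScaleReal Δ' q) :
    ∀ Δ : ℝ, 1 < Δ → ∀ T₁ T₂ : ℝ → ℝ[X] → ℝ[X] → ℝ, MomentAsymptotics 1 Δ T₁ T₂ →
      ∃ a b : ℝ, 1 ≤ a ∧ a < b ∧ b ≤ min Δ 2 ∧ a < 3 / 2 ∧ ∀ Δ' : ℝ, a < Δ' → Δ' < b →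
        secondMomentForm Δ' (X ^ 2) 1 + T₂ Δ' (X ^ 2) 1 < 2 * linForm Δ' (X ^ 2) 1 ^ 2 := by
  intro Δ hΔ T₁ T₂ hMA
  obtain ⟨b, hb, hwin⟩ := hIO
  refine ⟨1, min b (min Δ 2), le_rfl, lt_min hb (lt_min hΔ (by norm_num)), min_le_right _ _,
    by norm_num, fun Δ' h1' h2' ↦ ?_⟩
  have hΔ'b : Δ' < b := lt_of_lt_of_le h2' (min_le_left _ _)
  have hΔ'Δ : Δ' < Δ := lt_of_lt_of_le h2' ((min_le_right _ _).trans (min_le_left _ _))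
  obtain ⟨U, hU, hio⟩ := hwin Δ' h1' hΔ'b
  have hT₂ : T₂ Δ' (X ^ 2) 1 ≤ U := T₂_le_of_kernelExcess_io hMA h1' hΔ'Δ.le h1'.le hN hio
  exact (secondMomentForm_X_sq_add_lt_iff (by linarith) _).2 (lt_of_le_of_lt hT₂ hU)

/-- **Composition (by name).** Pt′ + N + H⁻_io,U ⇒ K_B: `upperSomewhere_X_sq_of_kernelExcess_io` gives S2u
from the stubs N and H⁻_io,U (R1/R2), and `beyondDiagonalBeatsQuarter_of_upperSomewhere_X_sq'` (p532279:
S2u ⇒ K_B given the in-range Petersson bound Pt′ — Cauchy–Schwarz floor — and the crux's own Bettin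
antecedent, `T₁ = 0`) concludes the crux BY NAME. -/
theorem BeyondDiagonalBeatsQuarter_of :
    Summit.Parity.GeneralizedHardyLittlewood.Theses.PrimeLevelFamEdge.BeyondDiagonalBeatsQuarter := by
  obtain ⟨C, M₀, hN⟩ := stub_kernelFormXSq
  exact beyondDiagonalBeatsQuarter_of_upperSomewhere_X_sq' stub_peterssonBound
    (upperSomewhere_X_sq_of_kernelExcess_io (KF := kernelFormXSq) (C := C) (M₀ := M₀) hN
      stub_kernelExcessBelowSlack_io)

end Summit.Parity.GeneralizedHardyLittlewood.Cruxes.BeyondDiagonalBeatsQuarter.DiagonalKernelSplit
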